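import Literature.AlgebraicGeometry.Resolution.ResolutionGlue
import Literature.AlgebraicGeometry.Resolution.ComponentGluing
import Literature.AlgebraicGeometry.Resolution.ResolutionLU
import Literature.AlgebraicGeometry.Resolution.AffineDomainDimension
import Literature.AlgebraicGeometry.Resolution.NormalizationOfVarietiesProofs
import Mathlib.AlgebraicGeometry.IdealSheaf.Functorial
import Mathlib.AlgebraicGeometry.Noetherian
import HarnessLib

/-!
# Resolution of singularities of curves (the dimension `≤ 1` case of Cossart–Piltant, Thm. 1.1)

Topic: `Literature/AlgebraicGeometry/Resolution`. The case `dim X ≤ 1` of the named fact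
`CossartPiltant2019` (`ResolutionOfSingularities.lean`; Cossart–Piltant 2019, Thm. 1.1 covers
all reduced separated quasi-excellent schemes of dimension `≤ 3`) is PROVED here over Mathlib:
every reduced scheme of finite type over a field `k` with `dim X ≤ 1` has a resolution of
singularities in the sense of `Scheme.HasResolution` — in fact a *finite* one, the disjoint union
of the normalizations of its irreducible components (Hartshorne, *Algebraic Geometry*, Ch. V,
Rem. 3.8.1: "If `V` is a curve … it is sufficient to take `V'` to be the normalization of `V`";
Kollár 2007, §1.4: 1.29 "Does the normalization give the resolution?", Thm. 1.30 (normal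
Noetherian domains of dimension one are regular), Thm. 1.33 (finiteness of normalization)).
This is the first non-trivial inhabitant of `IsBirational`/`IsResolution`/`Scheme.HasResolution`
for singular schemes, and the layer `d ≤ 1` of `ResolutionOverUpToDim k d`
(`ArithmeticalThreefolds.lean`).

## Content

* reduced closed subschemes `(vanishingIdeal Z).subscheme` (Mathlib's ideal sheaves):
  `isReduced_subscheme_vanishingIdeal`, `isIntegral_subscheme_vanishingIdeal` (for `Z`
  irreducible), `range_subschemeι_vanishingIdeal`, `isIso_subschemeι_vanishingIdeal_top`,
  the inclusion `X_Z ↪ X_{Z'}` for `Z ≤ Z'` (Mathlib `IdealSheafData.inclusion`, a closed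
  immersion) and its range `range_inclusion` — since `defn-ComponentGluing` these lemmas (and
  `mem_of_subset_biUnion_of_mem_irreducibleComponents`) are one-line restatements of their
  canonical copies `ComponentGluing.<same name>` in the narrow-import module
  `ComponentGluing.lean` (import that module when only this glue is needed);
* `exists_isIntegrallyClosed_localization_away` — if the normalization of a domain `A` is a
  finite `A`-module, some `A[1/s]`, `s ≠ 0`, is integrally closed (common denominator);
* `exists_isAffineOpen_isIntegrallyClosed` — an integral scheme locally of finite type over a
  field has a non-empty normal affine open (uses `NoetherFiniteIntegralClosure`, proved in
  `NormalizationOfVarietiesProofs.lean`); `isIso_normalizationι_morphismRestrict` — the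
  normalization is an isomorphism over it;
* `exists_finite_resolution_of_isIntegral` — the normalization of an integral curve is a finite
  resolution (with `isFinite_normalizationι`, `isRegular_normalization_of_dim_le_one`);
* `exists_finite_resolution_subscheme_biUnion` — induction on the number of irreducible
  components with the glue `exists_finite_resolution_of_closed_cover` (`ResolutionGlue.lean`);
* `exists_finite_resolution_of_dim_le_one`, `hasResolution_of_dim_le_one`,
  `resolutionOverUpToDim_one : ResolutionOverUpToDim k 1`, and the dimension-`≤ 1` case of
  `CossartPiltant2019` in its own wording, `cossartPiltant2019_dim_le_one` — all sorry-free and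
  unconditional;
* `localUniformization_dim_le_one` — consequently (valuative criterion, `ResolutionLU.lean`)
  Zariski local uniformization for affine models of dimension `≤ 1`, proved;
  `relLocalUniformization_of_trdeg_le_one` — `RelLocalUniformization k K O` for every valuation
  ring of every `K/k` of transcendence degree `≤ 1` (`dim = trdeg`, `AffineDomainDimension.lean`).

## Sources

* R. Hartshorne, *Algebraic Geometry*, GTM 52, Springer 1977, Ch. V, Rem. 3.8.1.
* J. Kollár, *Lectures on Resolution of Singularities*, Ann. of Math. Stud. 166, PUP 2007, §1.4
  (1.29, Thm. 1.30, Thm. 1.33).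
* V. Cossart, O. Piltant, J. Algebra 529 (2019) 268–535, Thm. 1.1 (the statement specialised).
-/

noncomputable section

open CategoryTheory CategoryTheory.Limits AlgebraicGeometry TopologicalSpace Topology

namespace Literature.AlgebraicGeometry.Resolution

universe u

/-! ## Reduced closed subschemes -/

section ReducedSubscheme

open Scheme.IdealSheafData

variable {X : Scheme.{u}}

/-- The closed subscheme of `X` defined by the vanishing ideal sheaf of a closed subset `Z` (the
reduced induced structure on `Z`) is reduced. [folklore] -/
theorem isReduced_subscheme_vanishingIdeal (Z : Closeds X) :
    IsReduced (vanishingIdeal Z).subscheme := ComponentGluing.isReduced_subscheme_vanishingIdeal Z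

/-- The points of the reduced closed subscheme on `Z` are the points of `Z`. [folklore] -/
theorem mem_of_subscheme_vanishingIdeal (Z : Closeds X) (x : (vanishingIdeal Z).subscheme) :
    (vanishingIdeal Z).subschemeι x ∈ Z := ComponentGluing.mem_of_subscheme_vanishingIdeal Z x

/-- The range of the inclusion of the reduced closed subscheme on `Z` is `Z`. [folklore] -/
theorem range_subschemeι_vanishingIdeal (Z : Closeds X) :
    Set.range (vanishingIdeal Z).subschemeι = (Z : Set X) :=
  ComponentGluing.range_subschemeι_vanishingIdeal Z

/-- The reduced closed subscheme on an irreducible closed subset is an integral scheme.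
[folklore] -/
theorem isIntegral_subscheme_vanishingIdeal (Z : Closeds X) (hZ : IsIrreducible (Z : Set X)) :
    IsIntegral (vanishingIdeal Z).subscheme :=
  ComponentGluing.isIntegral_subscheme_vanishingIdeal Z hZ

/-- The reduced closed subscheme on the empty closed subset is empty. [folklore] -/
theorem isEmpty_subscheme_vanishingIdeal_bot :
    IsEmpty (vanishingIdeal (⊥ : Closeds X)).subscheme :=
  ComponentGluing.isEmpty_subscheme_vanishingIdeal_bot

/-- For a reduced scheme, the inclusion of the reduced closed subscheme on all of `X` is an
isomorphism. [folklore] -/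
theorem isIso_subschemeι_vanishingIdeal_top [IsReduced X] :
    IsIso (vanishingIdeal (⊤ : Closeds X)).subschemeι :=
  ComponentGluing.isIso_subschemeι_vanishingIdeal_top

/-! The inclusion `inclusion h : X_Z ⟶ X_{Z'}` between the reduced closed subschemes on closed
subsets `Z ≤ Z'` (Mathlib's `IdealSheafData.inclusion`, for
`h : vanishingIdeal Z' ≤ vanishingIdeal Z`, e.g. `h = vanishingIdeal_antimono _`). -/

/-- The inclusion `X_Z ↪ X_{Z'}` is the identity on underlying points of `X`. [folklore] -/
theorem subschemeι_inclusion_apply {Z Z' : Closeds X} (h : vanishingIdeal Z' ≤ vanishingIdeal Z)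
    (x : (vanishingIdeal Z).subscheme) :
    ((vanishingIdeal Z').subschemeι (inclusion h x) : X) = (vanishingIdeal Z).subschemeι x :=
  ComponentGluing.subschemeι_inclusion_apply h x

/-- The range of the inclusion `X_Z ↪ X_{Z'}` of reduced closed subschemes consists of the points
of `X_{Z'}` lying in `Z`. [folklore] -/
theorem range_inclusion {Z Z' : Closeds X} (h : vanishingIdeal Z' ≤ vanishingIdeal Z) :
    Set.range (inclusion h) = (vanishingIdeal Z').subschemeι ⁻¹' (Z : Set X) :=
  ComponentGluing.range_inclusion h

end ReducedSubscheme

/-! ## A normal dense open of an integral variety; the normalization is an isomorphism over it -/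

section NormalOpen

/-- If the integral closure of a domain `A` in its fraction field is a finite `A`-module, then
some non-zero `s ∈ A` kills all denominators of integral elements, and `A[1/s]` is integrally
closed. [folklore] -/
theorem exists_isIntegrallyClosed_localization_away (A K : Type*) [CommRing A] [IsDomain A]
    [Field K] [Algebra A K] [IsFractionRing A K] (hfin : Module.Finite A (integralClosure A K)) :
    ∃ s : A, s ≠ 0 ∧ IsIntegrallyClosed (Localization.Away s) := by
  classical
  obtain ⟨S, hS⟩ := hfin.fg_top
  -- a common denominator for the generators
  obtain ⟨⟨d, hd⟩, hdS⟩ :=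
    IsLocalization.exist_integer_multiples_of_finset (nonZeroDivisors A)
      (S.image (fun b : integralClosure A K => (b : K)))
  have hd0 : d ≠ 0 := nonZeroDivisors.ne_zero hd
  -- `d` kills the denominators of every integral element
  have hdint : ∀ x : integralClosure A K, IsLocalization.IsInteger A (d • (x : K)) := by
    intro x
    have hx : x ∈ Submodule.span A (S : Set (integralClosure A K)) := by rw [hS]; trivial
    refine Submodule.span_induction ?_ ?_ ?_ ?_ hx
    · intro b hb
      exact hdS _ (Finset.mem_image_of_mem _ hb)
    · exact ⟨0, by simp⟩
    · rintro x y - - ⟨a, ha⟩ ⟨b, hb⟩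
      refine ⟨a + b, ?_⟩
      simp only [map_add, ha, hb, Subalgebra.coe_add, smul_add]
    · rintro a x - ⟨b, hb⟩
      refine ⟨a * b, ?_⟩
      rw [Subalgebra.coe_smul, smul_comm, ← hb, map_mul, Algebra.smul_def]
  refine ⟨d, hd0, ?_⟩
  -- `B = A[1/d]` with fraction field `K`
  set B := Localization.Away d
  letI : Algebra B K := (IsLocalization.map (M := Submonoid.powers d) (T := nonZeroDivisors A) K
    (RingHom.id A) (Submonoid.powers_le.mpr (mem_nonZeroDivisors_of_ne_zero hd0))).toAlgebra
  haveI : IsScalarTower A B K := IsScalarTower.of_algebraMap_eq' (by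
    rw [RingHom.algebraMap_toAlgebra, IsLocalization.map_comp, RingHomCompTriple.comp_eq])
  haveI : IsFractionRing B K :=
    IsFractionRing.isFractionRing_of_isDomain_of_isLocalization (Submonoid.powers d) B K
  refine (isIntegrallyClosed_iff K).mpr fun {x} hx => ?_
  obtain ⟨⟨_, n, rfl⟩, hn⟩ :=
    IsIntegral.exists_multiple_integral_of_isLocalization (Submonoid.powers d) (Rₘ := B) x hx
  obtain ⟨a, ha⟩ := hdint ⟨_, hn⟩
  -- `x = a / d^(n+1)`
  let t : Submonoid.powers d := ⟨d ^ (n + 1), n + 1, rfl⟩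
  refine ⟨IsLocalization.mk' B a t, ?_⟩
  have hK : algebraMap A K (d ^ (n + 1)) * x = algebraMap A K a := by
    rw [ha]
    simp only [Submonoid.smul_def, Algebra.smul_def, pow_succ, map_mul, map_pow]
    ring
  have hne : algebraMap A K (d ^ (n + 1)) ≠ 0 :=
    (map_ne_zero_iff _ (IsFractionRing.injective A K)).mpr (pow_ne_zero _ hd0)
  have : algebraMap B K (IsLocalization.mk' B a t) *
      algebraMap A K (d ^ (n + 1)) = algebraMap A K a := by
    rw [IsScalarTower.algebraMap_apply A B K (d ^ (n + 1)), ← map_mul,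
      show algebraMap A B (d ^ (n + 1)) = algebraMap A B (t : A) from rfl,
      IsLocalization.mk'_spec B a t, ← IsScalarTower.algebraMap_apply]
  calc algebraMap B K (IsLocalization.mk' B a t)
      = algebraMap A K a / algebraMap A K (d ^ (n + 1)) := by
        rw [eq_div_iff hne, this]
    _ = x := by rw [← hK, mul_comm, mul_div_assoc, div_self hne, mul_one]

variable (X : Scheme.{u}) [IsIntegral X]

/-- For an integral scheme locally of finite type over a field there is a non-empty affine open
with integrally closed coordinate ring (finiteness of normalization,
`NoetherFiniteIntegralClosure`, and a common denominator). [folklore] -/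
theorem exists_isAffineOpen_isIntegrallyClosed (hN : NoetherFiniteIntegralClosure.{u})
    {k : Type u} [Field k] (f : X ⟶ Spec (.of k)) [LocallyOfFiniteType f] :
    ∃ W : X.Opens, IsAffineOpen W ∧ (W : Set X).Nonempty ∧ IsIntegrallyClosed Γ(X, W) := by
  obtain ⟨x⟩ := (inferInstance : Nonempty X)
  obtain ⟨_, ⟨U, hU, rfl⟩, hxU, -⟩ :=
    X.isBasis_affineOpens.exists_subset_of_mem_open (Set.mem_univ x) isOpen_univ
  haveI : Nonempty U := ⟨⟨x, hxU⟩⟩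
  -- `A = Γ(X, U)` is a finitely generated `k`-domain with fraction field `K(X)`
  let A := Γ(X, U)
  let φ : k →+* A := (f.appLE ⊤ U le_top).hom.comp (Scheme.ΓSpecIso (.of k)).inv.hom
  have hφ : φ.FiniteType := by
    refine RingHom.FiniteType.comp ?_ (RingHom.FiniteType.of_surjective _
      (Scheme.ΓSpecIso (.of k)).symm.commRingCatIsoToRingEquiv.surjective)
    exact HasRingHomProperty.appLE @LocallyOfFiniteType f ‹_› ⟨⊤, isAffineOpen_top _⟩
      ⟨U, hU⟩ le_top
  letI : Algebra k A := φ.toAlgebra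
  haveI : Algebra.FiniteType k A := hφ
  haveI : IsFractionRing A X.functionField := functionField_isFractionRing_of_isAffineOpen X U hU
  obtain ⟨s, hs0, hs⟩ := exists_isIntegrallyClosed_localization_away A X.functionField
    (hN.self k A X.functionField)
  refine ⟨X.basicOpen s, hU.basicOpen s, ?_, ?_⟩
  · rw [Set.nonempty_iff_ne_empty, Ne, ← Opens.coe_bot, SetLike.coe_set_eq, basicOpen_eq_bot_iff]
    exact hs0
  · haveI := hU.isLocalization_basicOpen s
    exact IsIntegrallyClosed.of_equiv
      (IsLocalization.algEquiv (Submonoid.powers s) (Localization.Away s)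
        Γ(X, X.basicOpen s)).toRingEquiv

/-- The normalization of an integral scheme is an isomorphism over every non-empty affine open
with integrally closed coordinate ring. [folklore] -/
theorem isIso_normalizationι_morphismRestrict {W : X.Opens} (hW : IsAffineOpen W)
    (hWne : (W : Set X).Nonempty) (hic : IsIntegrallyClosed Γ(X, W)) :
    IsIso (normalizationι X ∣_ W) := by
  haveI : Nonempty W := by
    obtain ⟨x, hx⟩ := hWne
    exact ⟨⟨x, hx⟩⟩
  rw [isIso_morphismRestrict_iff_isIso_app _ hW, normalizationι,
    Scheme.Hom.fromNormalization_app _ hW]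
  letI := ((fromSpecFunctionField X).app W).hom.toAlgebra
  haveI : IsFractionRing Γ(X, W) X.functionField :=
    functionField_isFractionRing_of_isAffineOpen X W hW
  let e := functionFieldAlgEquivSections (X := X) W
  let L := Γ(Spec X.functionField, fromSpecFunctionField X ⁻¹ᵁ W)
  have hinj : Function.Injective (algebraMap Γ(X, W) (integralClosure Γ(X, W) L)) := by
    intro a b hab
    have hab' : algebraMap Γ(X, W) L a = algebraMap Γ(X, W) L b := congr_arg Subtype.val hab
    rw [← e.commutes a, ← e.commutes b] at hab'
    exact IsFractionRing.injective Γ(X, W) X.functionField (e.injective hab')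
  have hsurj : Function.Surjective (algebraMap Γ(X, W) (integralClosure Γ(X, W) L)) := by
    intro z
    have hz : IsIntegral Γ(X, W) (e.symm (z : L)) := z.2.map e.symm.toAlgHom
    obtain ⟨a, ha⟩ :=
      (IsIntegrallyClosed.isIntegral_iff (R := Γ(X, W)) (K := X.functionField)).mp hz
    refine ⟨a, Subtype.ext ?_⟩
    show algebraMap Γ(X, W) L a = z
    rw [← e.commutes a, ha, AlgEquiv.apply_symm_apply]
  have hiso : IsIso (CommRingCat.ofHom (algebraMap Γ(X, W) (integralClosure Γ(X, W) L))) :=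
    (RingEquiv.ofBijective _ ⟨hinj, hsurj⟩).toCommRingCatIso.isIso_hom
  exact @IsIso.comp_isIso _ _ _ _ _ _ _ hiso inferInstance

/-- **Finite resolution of an integral curve by normalization**: for an integral scheme `X`
locally of finite type over a field with `dim X ≤ 1`, the normalization `X^ν ⟶ X` is finite,
birational (an isomorphism over a normal dense open) and `X^ν` is regular. [folklore] -/
theorem exists_finite_resolution_of_isIntegral (hN : NoetherFiniteIntegralClosure.{u})
    {k : Type u} [Field k] (f : X ⟶ Spec (.of k)) [LocallyOfFiniteType f]
    (hdim : topologicalKrullDim X ≤ 1) :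
    ∃ (X' : Scheme.{u}) (π : X' ⟶ X),
      IsFinite π ∧ IsBirational π ∧ Scheme.IsRegular X' := by
  obtain ⟨W, hW, hWne, hic⟩ := exists_isAffineOpen_isIntegrallyClosed X hN f
  refine ⟨normalization X, normalizationι X, isFinite_normalizationι X hN f,
    ⟨W, ?_, ?_, ?_⟩, isRegular_normalization_of_dim_le_one X hN f hdim⟩
  · exact W.2.dense hWne
  · refine (normalizationι X ⁻¹ᵁ W).2.dense ?_
    obtain ⟨y, hy⟩ := (normalizationι X).denseRange.exists_mem_open W.2 hWne
    exact ⟨y, hy⟩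
  · exact isIso_normalizationι_morphismRestrict X hW hWne hic

end NormalOpen

/-! ## Resolution of reduced curves -/

section Curves

open Scheme.IdealSheafData

variable {k : Type u} [Field k]

/-- An irreducible component contained in a finite union of irreducible components is one of
them. [folklore] -/
theorem mem_of_subset_biUnion_of_mem_irreducibleComponents {α : Type*} [TopologicalSpace α]
    {Z : Set α} (hZ : Z ∈ irreducibleComponents α) (S : Finset (Set α))
    (hS : (S : Set (Set α)) ⊆ irreducibleComponents α) (h : Z ⊆ ⋃ W ∈ S, W) :
    Z ∈ S := ComponentGluing.mem_of_subset_biUnion_of_mem_irreducibleComponents hZ S hS h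

/-- **Finite resolution of a finite union of components of a reduced curve** (induction on the
number of components, gluing the normalizations of the components along
`exists_finite_resolution_of_closed_cover`). [folklore] -/
theorem exists_finite_resolution_subscheme_biUnion (hN : NoetherFiniteIntegralClosure.{u})
    (X : Scheme.{u}) (f : X ⟶ Spec (.of k)) [LocallyOfFiniteType f] [IsReduced X]
    (hdim : topologicalKrullDim X ≤ 1) (S : Finset (Set X))
    (hS : (S : Set (Set X)) ⊆ irreducibleComponents X) (T : Closeds X)
    (hT : (T : Set X) = ⋃ Z ∈ S, Z) :
    ∃ (X' : Scheme.{u}) (π : X' ⟶ (vanishingIdeal T).subscheme),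
      IsFinite π ∧ IsBirational π ∧ Scheme.IsRegular X' := by
  classical
  induction S using Finset.induction_on generalizing T with
  | empty =>
    -- the subscheme is empty, hence regular
    have hT' : (T : Set X) = ∅ := by simpa using hT
    haveI : IsEmpty (vanishingIdeal T).subscheme := ⟨fun x => by
      have := mem_of_subscheme_vanishingIdeal T x
      rw [← SetLike.mem_coe, hT'] at this
      exact this⟩
    exact Scheme.IsRegular.exists_finite fun x => (IsEmpty.false x).elim
  | insert Z S hZS ih =>
    have hZ : Z ∈ irreducibleComponents X := hS (Finset.mem_insert_self Z S)
    have hS' : (S : Set (Set X)) ⊆ irreducibleComponents X :=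
      fun W hW => hS (Finset.mem_insert_of_mem hW)
    -- the two closed pieces: `Z` and the union `T₂` of the other components
    let T₁ : Closeds X := ⟨Z, isClosed_of_mem_irreducibleComponents Z hZ⟩
    let T₂ : Closeds X := ⟨⋃ W ∈ S, W, isClosed_biUnion_finset fun W hW =>
      isClosed_of_mem_irreducibleComponents W (hS' hW)⟩
    have hT₁₂ : (T : Set X) = (T₁ : Set X) ∪ T₂ := by
      rw [hT, Finset.set_biUnion_insert]; rfl
    have h₁T : T₁ ≤ T := by
      intro x hx; rw [← SetLike.mem_coe, hT₁₂]; exact Or.inl hx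
    have h₂T : T₂ ≤ T := by
      intro x hx; rw [← SetLike.mem_coe, hT₁₂]; exact Or.inr hx
    -- `Z ⊄ T₂` and `W ⊄ Z` for `W ∈ S`
    have hZT₂ : ¬ (Z ⊆ (T₂ : Set X)) := fun h =>
      hZS (mem_of_subset_biUnion_of_mem_irreducibleComponents hZ S hS' h)
    have hWZ : ∀ W ∈ S, ¬ (W ⊆ Z) := by
      intro W hW h
      have : W = Z := Set.Subset.antisymm h ((hS' hW).2 hZ.1 h)
      exact hZS (this ▸ hW)
    -- the pieces as closed subschemes of `X_T`
    let ι₁ := inclusion (vanishingIdeal_antimono h₁T)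
    let ι₂ := inclusion (vanishingIdeal_antimono h₂T)
    haveI : IsReduced (vanishingIdeal T).subscheme := isReduced_subscheme_vanishingIdeal T
    -- resolution of the component `Z`: the normalization
    haveI : IsIntegral (vanishingIdeal T₁).subscheme :=
      isIntegral_subscheme_vanishingIdeal T₁ hZ.1
    have h₁ : ∃ (C' : Scheme.{u}) (ρ : C' ⟶ (vanishingIdeal T₁).subscheme),
        IsFinite ρ ∧ IsBirational ρ ∧ Scheme.IsRegular C' :=
      exists_finite_resolution_of_isIntegral _ hN ((vanishingIdeal T₁).subschemeι ≫ f)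
        (((vanishingIdeal T₁).subschemeι.isClosedEmbedding.isInducing
          |>.topologicalKrullDim_le).trans hdim)
    -- resolution of the rest: induction
    have h₂ := ih hS' T₂ rfl
    refine exists_finite_resolution_of_closed_cover ι₁ ι₂ ?_ ?_ ?_ h₁ h₂
    · -- jointly surjective
      refine Set.eq_univ_of_forall fun y => ?_
      have hy := mem_of_subscheme_vanishingIdeal T y
      rw [← SetLike.mem_coe, hT₁₂] at hy
      rcases hy with hy | hy
      · left; rw [range_inclusion]; exact hy
      · right; rw [range_inclusion]; exact hy
    · -- the complement of `T₂` is dense in `X_Z`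
      rw [range_inclusion]
      have hopen :
          IsOpen (ι₁ ⁻¹' ((vanishingIdeal T).subschemeι ⁻¹' (T₂ : Set X))ᶜ) :=
        (T₂.2.preimage (vanishingIdeal T).subschemeι.continuous).isOpen_compl.preimage
          ι₁.continuous
      refine hopen.dense ?_
      obtain ⟨x, hxZ, hxT₂⟩ := Set.not_subset.mp hZT₂
      have hx : x ∈ Set.range (vanishingIdeal T₁).subschemeι := by
        rw [range_subschemeι_vanishingIdeal]; exact hxZ
      obtain ⟨c, rfl⟩ := hx
      refine ⟨c, ?_⟩
      show (vanishingIdeal T).subschemeι (ι₁ c) ∉ (T₂ : Set X)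
      rw [subschemeι_inclusion_apply]
      exact hxT₂
    · -- the complement of `Z` is dense in `X_{T₂}`
      rw [range_inclusion, dense_iff_inter_open]
      intro O' hO' hO'ne
      obtain ⟨O, hO, rfl⟩ :=
        (vanishingIdeal T₂).subschemeι.isClosedEmbedding.isInducing.isOpen_iff.mp hO'
      obtain ⟨d₀, hd₀⟩ := hO'ne
      have hd₀T : (vanishingIdeal T₂).subschemeι d₀ ∈ (T₂ : Set X) :=
        mem_of_subscheme_vanishingIdeal T₂ d₀
      obtain ⟨W, hW, hd₀W⟩ := Set.mem_iUnion₂.mp hd₀T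
      have hWirr : IsPreirreducible W := (hS' hW).1.2
      obtain ⟨x, hxW, hxO, hxZ⟩ := hWirr O Zᶜ hO
        (isClosed_of_mem_irreducibleComponents Z hZ).isOpen_compl ⟨_, hd₀W, hd₀⟩
        (by
          obtain ⟨x, hxW, hxZ⟩ := Set.not_subset.mp (hWZ W hW)
          exact ⟨x, hxW, hxZ⟩)
      have hx : x ∈ Set.range (vanishingIdeal T₂).subschemeι := by
        rw [range_subschemeι_vanishingIdeal]; exact Set.mem_iUnion₂.mpr ⟨W, hW, hxW⟩
      obtain ⟨d, rfl⟩ := hx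
      refine ⟨d, hxO, ?_⟩
      show (vanishingIdeal T).subschemeι (ι₂ d) ∉ (T₁ : Set X)
      rw [subschemeι_inclusion_apply]
      exact hxZ

/-- **Resolution of singularities of reduced curves** (the dimension `≤ 1` case of
Cossart–Piltant 2019, Thm. 1.1, over a field): a reduced scheme of finite type over a field `k`
with `dim X ≤ 1` has a resolution — even a finite one, the disjoint union of the normalizations
of its irreducible components — given finiteness of normalization
(`NoetherFiniteIntegralClosure`, proved in `NormalizationOfVarietiesProofs.lean`).
[cite: CossartPiltant2019, Thm. 1.1 (case dim ≤ 1)] -/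
theorem exists_finite_resolution_of_dim_le_one (hN : NoetherFiniteIntegralClosure.{u})
    (X : Scheme.{u}) (f : X ⟶ Spec (.of k)) [LocallyOfFiniteType f] [QuasiCompact f]
    [IsReduced X] (hdim : topologicalKrullDim X ≤ 1) :
    ∃ (X' : Scheme.{u}) (π : X' ⟶ X),
      IsFinite π ∧ IsBirational π ∧ Scheme.IsRegular X' := by
  classical
  haveI : IsLocallyNoetherian X := LocallyOfFiniteType.isLocallyNoetherian f
  haveI : CompactSpace X := QuasiCompact.compactSpace_of_compactSpace f
  haveI : IsNoetherian X := {}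
  have hfin : (irreducibleComponents (X : Type u)).Finite :=
    TopologicalSpace.NoetherianSpace.finite_irreducibleComponents
  have h := exists_finite_resolution_subscheme_biUnion hN X f hdim hfin.toFinset
    (by simp) ⊤ (by
      refine (Set.eq_univ_of_forall fun x => ?_).trans Set.top_eq_univ.symm |>.symm
      exact Set.mem_iUnion₂.mpr ⟨irreducibleComponent x,
        hfin.mem_toFinset.mpr (irreducibleComponent_mem_irreducibleComponents x),
        mem_irreducibleComponent⟩)
  haveI := isIso_subschemeι_vanishingIdeal_top (X := X)
  exact exists_finite_resolution_of_iso (vanishingIdeal (⊤ : Closeds X)).subschemeι h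

/-- **Resolution of singularities of reduced curves, unconditionally**: a reduced scheme of finite
type over a field with `dim X ≤ 1` has a finite resolution (`NoetherFiniteIntegralClosure_holds`
feeds `exists_finite_resolution_of_dim_le_one`). [cite: Hartshorne1977, Ch. V Rem. 3.8.1] -/
theorem exists_finite_resolution_of_dim_le_one' (X : Scheme.{u}) (f : X ⟶ Spec (.of k))
    [LocallyOfFiniteType f] [QuasiCompact f] [IsReduced X] (hdim : topologicalKrullDim X ≤ 1) :
    ∃ (X' : Scheme.{u}) (π : X' ⟶ X),
      IsFinite π ∧ IsBirational π ∧ Scheme.IsRegular X' :=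
  exists_finite_resolution_of_dim_le_one NoetherFiniteIntegralClosure_holds X f hdim

/-- **Reduced curves over a field have a resolution of singularities** (`Scheme.HasResolution`),
unconditionally; separatedness is not needed. [cite: Hartshorne1977, Ch. V Rem. 3.8.1] -/
theorem hasResolution_of_dim_le_one (X : Scheme.{u}) (f : X ⟶ Spec (.of k))
    [LocallyOfFiniteType f] [QuasiCompact f] [IsReduced X] (hdim : topologicalKrullDim X ≤ 1) :
    Scheme.HasResolution X :=
  hasResolution_of_exists_finite (exists_finite_resolution_of_dim_le_one' X f hdim)

/-- **Resolution of curves over `k`**: `ResolutionOverUpToDim k 1` holds for every field `k`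
(reduced separated `k`-schemes of finite type of dimension `≤ 1` admit a resolution) — the layer
`d = 1` of the decomposition of `CossartPiltant2019` in `ArithmeticalThreefolds.lean`, proved.
[cite: CossartPiltant2019, Thm. 1.1 (case dim ≤ 1)] -/
theorem resolutionOverUpToDim_one (k : Type u) [Field k] : ResolutionOverUpToDim k 1 := by
  intro X f _ _ _ _ hdim
  exact hasResolution_of_dim_le_one X f (by exact_mod_cast hdim)

/-- `ResolutionOverUpToDim k d` for every `d ≤ 1`.
[cite: CossartPiltant2019, Thm. 1.1 (case dim ≤ 1)] -/
theorem resolutionOverUpToDim_of_le_one (k : Type u) [Field k] {d : ℕ} (hd : d ≤ 1) :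
    ResolutionOverUpToDim k d :=
  (resolutionOverUpToDim_one k).mono hd

/-- **The dimension `≤ 1` case of `CossartPiltant2019`, in its own wording, proved**: for every
field `k` (any characteristic) and every reduced separated `k`-scheme of finite type of
dimension `≤ 1`, a resolution exists. [cite: CossartPiltant2019, Thm. 1.1 (case dim ≤ 1)] -/
theorem cossartPiltant2019_dim_le_one :
    ∀ (k : Type u) [Field k] (X : Scheme.{u}) (f : X ⟶ Spec (.of k)),
      IsSeparated f → LocallyOfFiniteType f → QuasiCompact f → IsReduced X →
        topologicalKrullDim X ≤ 1 → Scheme.HasResolution X := by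
  intro k _ X f _ _ _ _ hdim
  exact hasResolution_of_dim_le_one X f hdim

/-- The dimension `≤ 1` case of resolution in characteristic `p` (`ResolutionInChar p` restricted
to curves), proved for every `p`. [cite: CossartPiltant2019, Thm. 1.1 (case dim ≤ 1)] -/
theorem resolutionInChar_dim_le_one (p : ℕ) :
    ∀ (k : Type u) [Field k] [CharP k p] (X : Scheme.{u}) (f : X ⟶ Spec (.of k)),
      IsSeparated f → LocallyOfFiniteType f → QuasiCompact f → IsReduced X →
        topologicalKrullDim X ≤ 1 → Scheme.HasResolution X := by
  intro k _ _ X f _ _ _ _ hdim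
  exact hasResolution_of_dim_le_one X f hdim

/-- **Local uniformization in dimension one, proved**: for every field `k`, function field
`K ⊇ k`, valuation ring `O` of `K` and finitely generated `k`-subalgebra `A ⊆ O` with `Frac A = K`
and `dim A ≤ 1`, some finitely generated `A ⊆ A' ⊆ O` is regular at the centre of `O`
(`ResolutionOverUpToDim.localUniformization` of `ResolutionLU.lean` — resolution gives local
uniformization by the valuative criterion — fed with `resolutionOverUpToDim_one`). [folklore] -/
theorem localUniformization_dim_le_one (k : Type u) [Field k] (K : Type u) [Field K] [Algebra k K]
    (O : ValuationSubring K) (A : Subalgebra k K) (hAO : A.toSubring ≤ O.toSubring) (hfg : A.FG)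
    (hfr : IsFractionRing A K) (hdim : ringKrullDim A ≤ 1) :
    ∃ (A' : Subalgebra k K) (h : A'.toSubring ≤ O.toSubring), A ≤ A' ∧ A'.FG ∧
      IsRegularLocalRing (Localization.AtPrime (centreIdeal A' O h)) :=
  (resolutionOverUpToDim_one k).localUniformization K O A hAO hfg hfr (by exact_mod_cast hdim)

/-- **Relative local uniformization in transcendence degree `≤ 1`, proved**: for all fields
`k ⊆ K` with `trdeg_k K ≤ 1` and every valuation ring `O` of `K`, every finitely generated model
`R ⊆ O` of `K/k` is dominated by a finitely generated `R ⊆ A ⊆ O` regular at the centre of `O`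
(`RelLocalUniformization k K O`, `RankOneReduction.lean`), from `localUniformization_dim_le_one`
and `dim = trdeg` for affine domains (`ringKrullDim_le_of_fg_of_trdeg_le`). [folklore] -/
theorem relLocalUniformization_of_trdeg_le_one (k K : Type) [Field k] [Field K] [Algebra k K]
    (hK : Algebra.trdeg k K ≤ 1) (O : ValuationSubring K) : RelLocalUniformization k K O := by
  intro R hfg hfr hRO
  haveI := hfr
  obtain ⟨A', h', hle, hfg', hreg⟩ := localUniformization_dim_le_one k K O R hRO hfg hfr
    (ringKrullDim_le_of_fg_of_trdeg_le R hfg (by exact_mod_cast hK))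
  exact ⟨A', h', hle, hfg', hreg⟩

end Curves

end Literature.AlgebraicGeometry.Resolution

end
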